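import Mathlib
import Summits.Schanuel.Schanuel.Theorems.RootDecomp1ELevelsSlices

-- `Summit.Schanuel.Schanuel.…` is the mandated layout of this single-problem summit (CONVENTIONS §1).
set_option linter.dupNamespace false

/-!
# RootDecomp1E, round 11 (lens 2 «LEVELS»), part 5: `Q₃ = (e^{√2}, e, 1, √2)` — a certified member of stmt-31410's
class at length `4` whose conclusion is OPEN, decided by the E²-cell

Supports `stmt-Schanuel-31410` / `stmt-Schanuel-25020`.  PORT of §7b of the lens-2 gen-11 node `Levels.lean`; imports
part 4 (`RootDecomp1ELevelsSlices`); same namespace.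
`Q₃` is ℚ-free (`Q₃_linearIndependent`), PLAIN (`Q₃_plain`) and SUB-MINIMAL (`Q₃_subMinimal`, a Grassmann argument
in `span_ℚ Q₃` plus Lindemann–Weierstrass at `(1, √2)`), so a member of stmt-31410's hypothesis class at the first open
length of its type-free component (`Q₃_mem_plainClass`); stmt-31410's conclusion at `Q₃` is EQUIVALENT to «`e^e`,
`e^{e^{√2}}` are not both algebraic over `ℚ(e, e^{√2})`» (`defectOne_at_Q₃_iff`, `plainDefectOne_at_Q₃`) — open — and
the E²-cell says the same there (`e2Based_at_Q₃`), its hypotheses holding at `((1, √2); Q₃)` by theorem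
(`Q₃_two_le_trdeg`).
-/

noncomputable section

namespace Summit.Schanuel.Schanuel.Theorems.RootDecomp1ELevels

open Complex IntermediateField
open Summit.Schanuel.Schanuel.Theses.RootDecomp1E (DefectOneSchanuel EStableDefectOne PlainDefectOne)
open Summit.Schanuel.Schanuel.Theorems.RootDecomp1EAnchor (isAlgebraic_of_mem_adjoin
  trdeg_adjoin_le_of_isAlgebraic mem_adjoin_of_mem_span exp_isAlgebraic_of_mem_span isAlgebraic_transfer
  trdeg_adjoin_le_nat trdeg_le_of_mem_span exists_nat_eq_of_le_natCast span_range_le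
  exists_basis_span_inf isAlgebraic_of_trdeg_sandwich isAlgebraic_of_le isAlgebraic_mul isAlgebraic_add)
open Summit.Schanuel.Schanuel.Theorems.RootDecomp1EEStableRung (defectOne_of_le_two)
open Summit.Schanuel.Schanuel.Theorems.RootDecomp1EModuleGrids (subMinimal_three rat_mul_pi_eq_rat)
open Summit.Schanuel.Schanuel.Theorems.RootDecomp1EModuleType (SubMinimalDefect)
open Summit.Schanuel.Schanuel.Theorems.RootDecomp1EEngineType (LWRich PeriodRich EngineRich
  EngineRichDefectOneAt EngineDarkDefectOneAt FirstFailureLayer defectOne_iff_typeSplit defectOne_iff_layers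
  trdeg_eq_nat le_trdeg_add_one_of_subMinimal two_le_trdeg_of_subMinimal trdeg_add_two_eq_of_firstFailure
  linearIndependent_comp_castLE two_le_trdeg_of_lwRich)
open Literature.NumberTheory.Transcendental (nesterenko nesterenko' algebraicIndependent_exp_holds
  transcendental_pi_holds transcendental_exp_holds transcendental_rat_cexp_one)

/-! ### §7b `Q₃ = (e^{√2}, e, 1, √2)`: a CERTIFIED member of stmt-31410's class at length `4` with OPEN conclusion -/

/-- The algebraic pair `(1, √2)`. -/
def algPair : Fin 2 → ℂ := ![(1 : ℂ), ((Real.sqrt 2 : ℝ) : ℂ)]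

/-- `(1, √2)` is ℚ-linearly independent. -/
theorem algPair_linearIndependent : LinearIndependent ℚ algPair := by
  have := algTriple_linearIndependent.comp ![(0 : Fin 3), 2] (injective_pair (by decide))
  convert this using 1
  ext i; fin_cases i <;> rfl

/-- Both coordinates of `(1, √2)` are algebraic. -/
theorem algPair_isAlgebraic : ∀ j, IsAlgebraic ℚ (algPair j) := by
  intro j
  fin_cases j
  · simpa [algPair] using isAlgebraic_one
  · exact algTriple_isAlgebraic 2

/-- `e, e^{√2}` are algebraically independent (Lindemann–Weierstrass at `(1, √2)`, tree theorem). -/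
theorem algebraicIndependent_e_expSqrtTwo : AlgebraicIndependent ℚ fun j => cexp (algPair j) :=
  algebraicIndependent_exp_holds algPair algPair_isAlgebraic algPair_linearIndependent

/-- Rational numbers are algebraic. -/
private theorem isAlgebraic_ratCast (q : ℚ) : IsAlgebraic ℚ (q : ℂ) := by
  simpa using isAlgebraic_algebraMap (R := ℚ) (A := ℂ) q

/-- **NO ALGEBRAIC RELATION `c₁ e^{√2} + c₂ e = a`** (`c₁, c₂, a ∈ ℚ̄`) except the trivial one: if `c₁ ≠ 0` then
`ℚ(c₁, c₂, a, e)` has transcendence degree `≤ 1` and contains `e, e^{√2}` (degree `2`); if `c₁ = 0 ≠ c₂`, `e ∈ ℚ̄`. -/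
theorem expPair_relation_trivial {c₁ c₂ a : ℂ} (hc₁ : IsAlgebraic ℚ c₁) (hc₂ : IsAlgebraic ℚ c₂)
    (ha : IsAlgebraic ℚ a) (h : c₁ * cexp ((Real.sqrt 2 : ℝ) : ℂ) + c₂ * cexp 1 = a) : c₁ = 0 ∧ c₂ = 0 := by
  by_cases h1 : c₁ = 0
  · subst h1
    refine ⟨rfl, ?_⟩
    by_contra h2
    have he : cexp 1 = a / c₂ := by
      field_simp
      linear_combination h
    refine transcendental_rat_cexp_one ?_
    rw [he]
    exact mem_algebraicClosure_iff.mp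
      (div_mem (mem_algebraicClosure_iff.mpr ha) (mem_algebraicClosure_iff.mpr hc₂))
  · exfalso
    set L : IntermediateField ℚ ℂ := adjoin ℚ ({c₁, c₂, a, cexp 1} : Set ℂ) with hL
    have hLle : Algebra.trdeg ℚ ↥L ≤ ((1 : ℕ) : Cardinal) := by
      refine (trdeg_adjoin_le_of_isAlgebraic (K := adjoin ℚ ({cexp 1} : Set ℂ)) ?_).trans
        (trdeg_expField_le_one 1)
      rintro x (rfl | rfl | rfl | rfl)
      · exact hc₁.tower_top _
      · exact hc₂.tower_top _
      · exact ha.tower_top _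
      · exact isAlgebraic_of_mem_adjoin (mem_adjoin_simple_self ℚ _)
    have hc₁L : c₁ ∈ L := subset_adjoin ℚ _ (by simp)
    have hc₂L : c₂ ∈ L := subset_adjoin ℚ _ (by simp)
    have haL : a ∈ L := subset_adjoin ℚ _ (by simp)
    have heL : cexp 1 ∈ L := subset_adjoin ℚ _ (by simp)
    have hfL : cexp ((Real.sqrt 2 : ℝ) : ℂ) ∈ L := by
      have : cexp ((Real.sqrt 2 : ℝ) : ℂ) = (a - c₂ * cexp 1) / c₁ := by
        field_simp
        linear_combination h
      rw [this]
      exact div_mem (sub_mem haL (mul_mem hc₂L heL)) hc₁L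
    have h2 : ((2 : ℕ) : Cardinal) ≤ Algebra.trdeg ℚ ↥L :=
      le_trdeg_of_algebraicIndependent algebraicIndependent_e_expSqrtTwo fun i => by
        fin_cases i
        · simpa [algPair] using heL
        · simpa [algPair] using hfL
    have : (2 : ℕ) ≤ 1 := by exact_mod_cast h2.trans hLle
    omega

/-- `Q₃ = (e^{√2}, e, 1, √2)` — two EXPONENTIALS of algebraic numbers over the algebraic pair `(1, √2)`. -/
def Q₃ : Fin 4 → ℂ := ![cexp ((Real.sqrt 2 : ℝ) : ℂ), cexp 1, (1 : ℂ), ((Real.sqrt 2 : ℝ) : ℂ)]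

/-- `Q₃ = (e^{√2}, e, 1, √2)` as an iterated `Fin.cons` over `algPair`. -/
theorem Q₃_eq_cons : Q₃ = Fin.cons (cexp ((Real.sqrt 2 : ℝ) : ℂ)) (Fin.cons (cexp 1) algPair) := by
  ext i; fin_cases i <;> rfl

/-- The algebraic pair `(1, √2)` lies in the ℚ-span of `Q₃`. -/
theorem algPair_mem_span_Q₃ (j : Fin 2) : algPair j ∈ Submodule.span ℚ (Set.range Q₃) :=
  Submodule.subset_span ⟨j.succ.succ, by fin_cases j <;> rfl⟩

/-- `Q₃` is ℚ-FREE (the tail `(e | 1, √2)` is free by the transcendence of `e`; `e^{√2} ∉ span_ℚ(e, 1, √2)` by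
`expPair_relation_trivial`). -/
theorem Q₃_linearIndependent : LinearIndependent ℚ Q₃ := by
  rw [Q₃_eq_cons, linearIndependent_finCons]
  refine ⟨cons_linearIndependent transcendental_rat_cexp_one algPair_linearIndependent algPair_isAlgebraic, fun hmem => ?_⟩
  obtain ⟨q, p, hp, hpe⟩ := (mem_span_cons_iff _).mp hmem
  have hpalg : IsAlgebraic ℚ p := isAlgebraic_of_mem_span_of_isAlgebraic algPair_isAlgebraic hp
  have hq : IsAlgebraic ℚ (-(q : ℂ)) := by simpa using isAlgebraic_ratCast (-q)
  have hrel : (1 : ℂ) * cexp ((Real.sqrt 2 : ℝ) : ℂ) + (-(q : ℂ)) * cexp 1 = p := by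
    rw [hpe, Rat.smul_def]; ring
  exact one_ne_zero (expPair_relation_trivial isAlgebraic_one hq hpalg hrel).1

/-- `Q₃` is PLAIN: an algebraic `β` with `β · e ∈ span_ℚ Q₃` is rational (`expPair_relation_trivial`). -/
theorem Q₃_plain (β : ℂ) (hβ : IsAlgebraic ℚ β) (h : ∀ i, β * Q₃ i ∈ Submodule.span ℚ (Set.range Q₃)) :
    β ∈ Set.range (algebraMap ℚ ℂ) := by
  have h1 := h 1
  have hQ1 : Q₃ 1 = cexp 1 := rfl
  rw [hQ1, Q₃_eq_cons] at h1
  obtain ⟨q₁, r, hr, hre⟩ := (mem_span_cons_iff _).mp h1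
  obtain ⟨q₂, p, hp, hpe⟩ := (mem_span_cons_iff _).mp hr
  have hpalg : IsAlgebraic ℚ p := isAlgebraic_of_mem_span_of_isAlgebraic algPair_isAlgebraic hp
  have hrel : (-(q₁ : ℂ)) * cexp ((Real.sqrt 2 : ℝ) : ℂ) + (β - q₂) * cexp 1 = p := by
    have : β * cexp 1 = q₁ • cexp ((Real.sqrt 2 : ℝ) : ℂ) + (q₂ • cexp 1 + p) := by rw [hre, hpe]
    rw [Rat.smul_def, Rat.smul_def] at this
    linear_combination this
  have hq₁ : IsAlgebraic ℚ (-(q₁ : ℂ)) := by simpa using isAlgebraic_ratCast (-q₁)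
  have hβq : IsAlgebraic ℚ (β - q₂) := mem_algebraicClosure_iff.mp
    (sub_mem (mem_algebraicClosure_iff.mpr hβ) (mem_algebraicClosure_iff.mpr (isAlgebraic_ratCast q₂)))
  have h0 := (expPair_relation_trivial hq₁ hβq hpalg hrel).2
  exact ⟨q₂, by rw [eq_ratCast]; exact (sub_eq_zero.mp h0).symm⟩

/-- **GRASSMANN STEP**: every ℚ-free triple `w` inside `span_ℚ Q₃` has `e, e^{√2} ∈ F_w^{alg}` — `span w` (dim 3)
meets `A = span(1, √2)` (dim 2) inside `span Q₃` (dim 4); either `A ⊆ span w` (then `e = e¹, e^{√2}` are exponentials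
of span elements) or `span w + A = span Q₃` (then `e, e^{√2}` are algebraic translates of elements of `span w`). -/
theorem expPair_isAlgebraic_of_triple {w : Fin 3 → ℂ} (hw : LinearIndependent ℚ w)
    (hmem : ∀ j, w j ∈ Submodule.span ℚ (Set.range Q₃)) :
    ∀ j, IsAlgebraic ↥(adjoin ℚ (Set.range w ∪ Set.range (cexp ∘ w))) (cexp (algPair j)) := by
  classical
  set W : Submodule ℚ ℂ := Submodule.span ℚ (Set.range w) with hW
  set A : Submodule ℚ ℂ := Submodule.span ℚ (Set.range algPair) with hA
  set V : Submodule ℚ ℂ := Submodule.span ℚ (Set.range Q₃) with hV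
  haveI : FiniteDimensional ℚ ↥W := FiniteDimensional.span_of_finite ℚ (Set.finite_range _)
  haveI : FiniteDimensional ℚ ↥A := FiniteDimensional.span_of_finite ℚ (Set.finite_range _)
  haveI : FiniteDimensional ℚ ↥V := FiniteDimensional.span_of_finite ℚ (Set.finite_range _)
  have hW3 : Module.finrank ℚ ↥W = 3 := by simpa using finrank_span_eq_card hw
  have hA2 : Module.finrank ℚ ↥A = 2 := by simpa using finrank_span_eq_card algPair_linearIndependent
  have hVle : Module.finrank ℚ ↥V ≤ 4 := (finrank_range_le_card _).trans (Fintype.card_fin _).le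
  have hWV : W ≤ V := span_range_le hmem
  have hAV : A ≤ V := span_range_le algPair_mem_span_Q₃
  have hdim := Submodule.finrank_sup_add_finrank_inf_eq W A
  have hsup_le : Module.finrank ℚ ↥(W ⊔ A) ≤ Module.finrank ℚ ↥V := Submodule.finrank_mono (sup_le hWV hAV)
  rw [hW3, hA2] at hdim
  by_cases hinf : 2 ≤ Module.finrank ℚ ↥(W ⊓ A)
  · -- `A ⊆ span w`: the exponentials `e, e^{√2}` of span elements are algebraic over `F_w`
    have hEq : W ⊓ A = A := Submodule.eq_of_le_of_finrank_le inf_le_right (by rw [hA2]; exact hinf)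
    have hAW : A ≤ W := hEq ▸ (inf_le_left : W ⊓ A ≤ W)
    intro j
    exact exp_isAlgebraic_of_mem_span (hAW (Submodule.subset_span ⟨j, rfl⟩))
  · -- `span w + A = span Q₃ ∋ e, e^{√2}`: algebraic translates
    have hWA : W ⊔ A = V := Submodule.eq_of_le_of_finrank_le (sup_le hWV hAV) (by omega)
    intro j
    have hQ : cexp (algPair j) ∈ W ⊔ A := by
      rw [hWA]
      fin_cases j
      · exact Submodule.subset_span ⟨1, rfl⟩
      · exact Submodule.subset_span ⟨0, rfl⟩
    obtain ⟨y, hy, a, ha, hya⟩ := Submodule.mem_sup.mp hQ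
    rw [← hya]
    exact isAlgebraic_add (isAlgebraic_of_mem_adjoin (mem_adjoin_of_mem_span hy))
      ((isAlgebraic_of_mem_span_of_isAlgebraic algPair_isAlgebraic ha).tower_top _)

/-- `Q₃` is SUB-MINIMAL: every ℚ-free triple of its span has `trdeg F_w ≥ 2` (pairs never fail). -/
theorem Q₃_subMinimal : SubMinimalDefect 4 Q₃ := by
  intro m w hm hw hmem
  rcases Nat.lt_or_ge m 3 with hm3 | hm3
  · exact defectOne_of_le_two m (by omega) w hw
  · obtain rfl : m = 3 := by omega
    have h2 := Summit.Schanuel.Schanuel.Theorems.RootDecomp1EEngineType.two_le_trdeg_of_algebraicIndependent_of_isAlgebraic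
      w algebraicIndependent_e_expSqrtTwo (expPair_isAlgebraic_of_triple hw hmem)
    calc ((3 : ℕ) : Cardinal) = 2 + 1 := by norm_num
      _ ≤ _ := add_le_add h2 le_rfl

/-- **`Q₃` IS A MEMBER OF stmt-31410's HYPOTHESIS CLASS AT LENGTH 4** (ℚ-free ∧ plain ∧ sub-minimal), certified. -/
theorem Q₃_mem_plainClass :
    LinearIndependent ℚ Q₃ ∧
      (∀ β : ℂ, IsAlgebraic ℚ β → (∀ i, β * Q₃ i ∈ Submodule.span ℚ (Set.range Q₃)) →
        β ∈ Set.range (algebraMap ℚ ℂ)) ∧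
      (∀ (m : ℕ) (w : Fin m → ℂ), m < 4 → LinearIndependent ℚ w →
        (∀ j, w j ∈ Submodule.span ℚ (Set.range Q₃)) →
        (m : Cardinal) ≤ Algebra.trdeg ℚ ↥(IntermediateField.adjoin ℚ (Set.range w ∪ Set.range (Complex.exp ∘ w))) + 1) :=
  ⟨Q₃_linearIndependent, Q₃_plain, Q₃_subMinimal⟩

/-- `Q₃` has level `≥ 2`, hence `trdeg F_{Q₃} ≥ 2` (the E²-cell's non-degeneracy hypothesis, certified). -/
theorem Q₃_lwLevel : LWLevel 2 Q₃ :=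
  ⟨algPair, algPair_linearIndependent, algPair_isAlgebraic, fun j => exp_isAlgebraic_of_mem_span (algPair_mem_span_Q₃ j)⟩

/-- `2 ≤ trdeg ℚ(Q₃, e^{Q₃})` by the level inequality (LW level 2). -/
theorem Q₃_two_le_trdeg : (2 : Cardinal) ≤ Algebra.trdeg ℚ ↥(adjoin ℚ (Set.range Q₃ ∪ Set.range (cexp ∘ Q₃))) := by
  exact_mod_cast le_trdeg_of_lwLevel Q₃ Q₃_lwLevel

/-- If `e^e` and `e^{e^{√2}}` were both algebraic over `K = ℚ(e, e^{√2})`, all eight generators of `F_{Q₃}` would be. -/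
theorem Q₃_gens_isAlgebraic
    (hee : IsAlgebraic ↥(adjoin ℚ (Set.range (cexp ∘ algPair))) (cexp (cexp 1)))
    (hef : IsAlgebraic ↥(adjoin ℚ (Set.range (cexp ∘ algPair))) (cexp (cexp ((Real.sqrt 2 : ℝ) : ℂ)))) :
    ∀ i, IsAlgebraic ↥(adjoin ℚ (Set.range (cexp ∘ algPair))) (Q₃ i) ∧
      IsAlgebraic ↥(adjoin ℚ (Set.range (cexp ∘ algPair))) (cexp (Q₃ i)) := by
  have hK : ∀ j, cexp (algPair j) ∈ adjoin ℚ (Set.range (cexp ∘ algPair)) := fun j => subset_adjoin ℚ _ ⟨j, rfl⟩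
  have he : cexp 1 ∈ adjoin ℚ (Set.range (cexp ∘ algPair)) := hK 0
  have hf : cexp ((Real.sqrt 2 : ℝ) : ℂ) ∈ adjoin ℚ (Set.range (cexp ∘ algPair)) := hK 1
  have h1 : IsAlgebraic ↥(adjoin ℚ (Set.range (cexp ∘ algPair))) (1 : ℂ) := isAlgebraic_one
  have hs : IsAlgebraic ↥(adjoin ℚ (Set.range (cexp ∘ algPair))) ((Real.sqrt 2 : ℝ) : ℂ) :=
    (algPair_isAlgebraic 1).tower_top _
  intro i
  fin_cases i
  · exact ⟨isAlgebraic_of_mem_adjoin hf, hef⟩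
  · exact ⟨isAlgebraic_of_mem_adjoin he, hee⟩
  · exact ⟨h1, by simpa [Q₃] using isAlgebraic_of_mem_adjoin he⟩
  · exact ⟨hs, isAlgebraic_of_mem_adjoin hf⟩

/-- **31410's CONCLUSION AT `Q₃` IS EXACTLY THE OPEN STATEMENT** «`e^e`, `e^{e^{√2}}` not both algebraic over
`K = ℚ(e, e^{√2})`»: (⟸) if `trdeg F_{Q₃} ≤ 2` then, `K ⊆ F_{Q₃}` having transcendence degree `2` (Lindemann–Weierstrass),
`F_{Q₃}` is algebraic over `K` (sandwich), in particular `e^e, e^{e^{√2}} ∈ F_{Q₃}` are; (⟹) `Q₃_gens_isAlgebraic`. -/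
theorem defectOne_at_Q₃_iff :
    (4 : Cardinal) ≤ Algebra.trdeg ℚ ↥(adjoin ℚ (Set.range Q₃ ∪ Set.range (cexp ∘ Q₃))) + 1 ↔
      ¬ (IsAlgebraic ↥(adjoin ℚ (Set.range (cexp ∘ algPair))) (cexp (cexp 1)) ∧
          IsAlgebraic ↥(adjoin ℚ (Set.range (cexp ∘ algPair))) (cexp (cexp ((Real.sqrt 2 : ℝ) : ℂ)))) := by
  obtain ⟨s, hs, _⟩ := trdeg_eq_nat Q₃
  have hSge : ((2 : ℕ) : Cardinal) ≤ Algebra.trdeg ℚ ↥(adjoin ℚ (Set.range (cexp ∘ algPair))) :=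
    le_trdeg_of_algebraicIndependent algebraicIndependent_e_expSqrtTwo (fun j => subset_adjoin ℚ _ ⟨j, rfl⟩)
  have hST : Set.range (cexp ∘ algPair) ⊆ Set.range Q₃ ∪ Set.range (cexp ∘ Q₃) := by
    rintro x ⟨j, rfl⟩
    fin_cases j
    · exact Or.inr ⟨2, by simp [Q₃, algPair]⟩
    · exact Or.inr ⟨3, by simp [Q₃, algPair]⟩
  constructor
  · rintro h4 ⟨hee, hef⟩
    have hall := Q₃_gens_isAlgebraic hee hef
    have hFle : Algebra.trdeg ℚ ↥(adjoin ℚ (Set.range Q₃ ∪ Set.range (cexp ∘ Q₃))) ≤ ((2 : ℕ) : Cardinal) := by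
      refine (trdeg_adjoin_le_of_isAlgebraic (K := adjoin ℚ (Set.range (cexp ∘ algPair))) ?_).trans
        (trdeg_expPairField_le_two algPair)
      rintro x (⟨i, rfl⟩ | ⟨i, rfl⟩)
      · exact (hall i).1
      · exact (hall i).2
    rw [hs] at h4 hFle
    have h4' : 4 ≤ s + 1 := by exact_mod_cast h4
    have h2' : s ≤ 2 := by exact_mod_cast hFle
    omega
  · intro h
    rw [hs]
    by_contra hlt
    have hs2 : s ≤ 2 := by
      have : ¬ 4 ≤ s + 1 := fun h' => hlt (by exact_mod_cast h')
      omega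
    have hTle : Algebra.trdeg ℚ ↥(adjoin ℚ (Set.range Q₃ ∪ Set.range (cexp ∘ Q₃))) ≤ ((2 : ℕ) : Cardinal) := by
      rw [hs]; exact_mod_cast hs2
    have halg : ∀ x ∈ adjoin ℚ (Set.range Q₃ ∪ Set.range (cexp ∘ Q₃)),
        IsAlgebraic ↥(adjoin ℚ (Set.range (cexp ∘ algPair))) x := fun x hx =>
      isAlgebraic_of_trdeg_sandwich hx hST hTle hSge
    exact h ⟨halg _ (subset_adjoin ℚ _ (Or.inr ⟨1, rfl⟩)), halg _ (subset_adjoin ℚ _ (Or.inr ⟨0, rfl⟩))⟩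

/-- **WHAT THE RESIDUAL SAYS AT `Q₃`**: stmt-31410's conclusion at its certified member `Q₃` implies that `e^e` and
`e^{e^{√2}}` are NOT BOTH algebraic over `ℚ(e, e^{√2})` — OPEN (Lindemann–Weierstrass gives `trdeg F_{Q₃} ≥ 2`, the
grid theorems of FNT Ch. 14 do not reach `e^e`; it implies `e^e ∉ ℚ̄ ∨ e^{e^{√2}} ∉ ℚ̄`). -/
theorem plainDefectOne_at_Q₃ (hP : PlainDefectOne) :
    ¬ (IsAlgebraic ↥(adjoin ℚ (Set.range (cexp ∘ algPair))) (cexp (cexp 1)) ∧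
        IsAlgebraic ↥(adjoin ℚ (Set.range (cexp ∘ algPair))) (cexp (cexp ((Real.sqrt 2 : ℝ) : ℂ)))) :=
  defectOne_at_Q₃_iff.mp (hP 4 Q₃ Q₃_linearIndependent Q₃_plain Q₃_subMinimal)

/-- **THE E²-CELL AT `Q₃`**: its hypotheses hold at `((1, √2); Q₃)` by THEOREM and its conclusion there is the same
open statement — the cell is the exact piece of the type-free layer `4` that decides 31410 at `Q₃` (E-R11 (b)). -/
theorem e2Based_at_Q₃ (h : E2BasedDefectOneFour) :
    ¬ (IsAlgebraic ↥(adjoin ℚ (Set.range (cexp ∘ algPair))) (cexp (cexp 1)) ∧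
        IsAlgebraic ↥(adjoin ℚ (Set.range (cexp ∘ algPair))) (cexp (cexp ((Real.sqrt 2 : ℝ) : ℂ)))) := by
  rintro ⟨hee, hef⟩
  exact h algPair algPair_linearIndependent algPair_isAlgebraic Q₃ Q₃_linearIndependent Q₃_two_le_trdeg
    (Q₃_gens_isAlgebraic hee hef)

end Summit.Schanuel.Schanuel.Theorems.RootDecomp1ELevels

end
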